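import Summits.HodgeConjecture.HodgeConjecture.Theses.HeckePrymWeil
import Literature.AlgebraicGeometry.Motives.AbelianVarietyProjectiveChart
import Literature.AlgebraicGeometry.Motives.PrymVariety
import Literature.AlgebraicGeometry.Motives.Jacobian
import Literature.AlgebraicGeometry.Motives.FamiliesVHS
import Literature.AlgebraicGeometry.HodgeTheory.FermatHypersurfaceReduction
import Literature.AlgebraicGeometry.HodgeTheory.GlobalInvariantCycles
import Literature.AlgebraicGeometry.HodgeTheory.DirectImageCovering
import Literature.AlgebraicTopology.SingularHomology.CupProductExteriorH1
import Literature.AlgebraicTopology.SingularHomology.CompactGroupExteriorCohomology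
import Literature.AlgebraicTopology.SingularHomology.BettiNumberBaseChange
import Literature.AlgebraicTopology.SingularHomology.UniversalCoefficientsField
import Literature.AlgebraicGeometry.Motives.AbelianVarietyComplexPoints
import Literature.AlgebraicGeometry.Motives.AbelianVarietyFundamentalGroup
import Literature.AlgebraicGeometry.Motives.AbelianVarietyTorsionPointsCountProofs
import Literature.AlgebraicGeometry.HodgeTheory.WeilClassesCyclicPrym
import Summits.HodgeConjecture.HodgeConjecture.Theorems.HeckePrymWeilHyperbolicEightfoldsSqrtMinus7AbstractSwitch
import Summits.HodgeConjecture.HodgeConjecture.Theorems.HeckePrymWeilHyperbolicEightfoldsSqrtMinus7SwitchTransfer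
import Summits.HodgeConjecture.HodgeConjecture.Theorems.HeckePrymWeilHyperbolicEightfoldsSqrtMinus7EndAdditiveH1
import Summits.HodgeConjecture.HodgeConjecture.Theorems.HeckePrymWeilHyperbolicEightfoldsSqrtMinus7SchoenDicyclic
import Summits.HodgeConjecture.HodgeConjecture.Theorems.HeckePrymWeilHeckePrymAnchorsGlobalClassOfSection
import Summits.HodgeConjecture.HodgeConjecture.Theorems.HeckePrymWeilHeckePrymAnchorsRationalAlongSection
import Summits.HodgeConjecture.HodgeConjecture.Theorems.HeckePrymWeilHeckePrymAnchorsOfStubs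
import HarnessLib

/-!
# `HyperbolicEightfoldsSqrtMinus7` from the line's stubs — fully hypothetical composition
# (item stmt-HodgeConjecture-14642, route HeckePrymWeil, line `Sketch` = idea `dicyclic-quaternion-switch`)

The crux `HeckePrymWeil.HyperbolicEightfoldsSqrtMinus7` (Hodge–Weil classes on SPLIT `ℚ(√-7)`-Weil
abelian eightfolds are algebraic; open in print) REDUCED, kernel-checked, to six statements, four of which
are published theorems (three already named facts of the tree):

* `hSch : HodgeTheory.Schoen1988_cyclicPrym_weilClasses_algebraic_degreeSix` (Schoen 1988 Cor. 3.1 =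
  Patel–Zhang 2025 Thm 5.3; named fact, file `Literature/AlgebraicGeometry/HodgeTheory/WeilClassesCyclicPrym`);
* `hD : HodgeTheory.deligne_globalInvariantCycles` (Deligne, Hodge II 4.1.1; named fact);
* `hHir` : the body of `HodgeTheory.Hironaka1964_smoothCompactification` (Hironaka 1964; named fact);
* `hCS : HodgeTheory.charlesSchnell_hodgeClass_of_flat` (Charles–Schnell Prop. 11.3.5 (1); named fact);
* `hPel` : PEL REACH — the polarized `√-7`-Weil family of the split component through a hyperbolic
  `(A, φ)` (embedded smooth projective over a smooth irreducible quasi-projective base) with a CONTINUOUS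
  section of the espace étalé `FiberClass f 8` through the given class, valued fibrewise in typed Weil
  planes, and a fibre carrying the dicyclic quaternionic structure `(φ_Y, ψ_Y)` with its
  `ℚ(√-3)`-isogeny pair towards Schoen's primitive Prym `(B, m·ψ₀)` of an étale `Dic₃`-cover of a genus-3
  curve (Deligne LNM 900 proof of 4.8 / Shimura 1963 for the family; Landherr 1936 + the lead's computation
  `falsifier1-dicyclic-disc.md` — the dicyclic anchors are SPLIT — for the membership; the one construction
  the tree lacks: no moduli of PEL type / universal family);
* `hT` : TRANSPORT (C⁺, OPEN) — variational Hodge for typed Weil classes along such a family from a fibre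
  with definite-quaternionic multiplication (an instance of the route crux `WeilVariationalHodge` at `(7,4)`,
  stmt-HodgeConjecture-14497).

Everything else is PROVED in the tree and assembled here (`stub_abstractSwitch` p92596, `stub_switchTransfer`
p90051, `stub_endAdditiveH1` p90289, `stub_schoenDicyclic_of_schoen` p90404, the W-engine
`stub_globalClassOfSection`/`stub_rationalAlongSection` of the sibling crux `HeckePrymAnchors`) plus, new
here, `stub_exteriorH1` and `stub_reach_of_pelReach`.  = the skeleton `Cruxes/HyperbolicEightfoldsSqrtMinus7/
Lines/Sketch.lean` (v4) with its six registered `sorry`-stubs turned into hypotheses; no definition.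
-/

noncomputable section

-- single-problem summit (Problem = Summit): the mandated namespace repeats `HodgeConjecture`.
set_option linter.dupNamespace false

open CategoryTheory MonoidalCategory
open Literature.AlgebraicGeometry Literature.AlgebraicGeometry.Motives
  Literature.AlgebraicGeometry.HodgeTheory Literature.AlgebraicTopology.SingularHomology
open Summit.HodgeConjecture.HodgeConjecture.Theorems.HeckePrymWeilLine
  (stub_globalClassOfSection stub_rationalAlongSection owf_isoTransport)

namespace Summit.HodgeConjecture.HodgeConjecture.Theorems.HyperbolicEightfoldsSqrtMinus7.DicyclicQuaternionSwitch

/-- **Stub 3 of the line — `H•(A(ℂ); ℂ) = ⋀•H¹(A(ℂ); ℂ)` with `dim H¹ = 2 dim A`** (the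
`HasExteriorCohomologyH1 ∧ finrank` part of the named fact `Motives.abelianVarietyCohomologyExteriorH1`,
Lange–Birkenhake Lemma 1.1.17 / Exercise 1.1.6 (7)–(8)), PROVED exactly as the tree's discharge
`abelianVarietyCohomologyExteriorH1_holds` (p94821): `b₁(A(ℂ); ℂ) = 2 dim A` from the count of torsion
points (`finrank_bettiCohomology_one_eq_of_natCard_torsionPoints`, universal coefficients over a field), and
the Hopf-type theorem `hasExteriorCohomologyH1_of_group` for the compact connected group `2 dim A`-manifold
`A(ℂ)`.  (Repeated rather than quoted because the hub olean of that module predates the discharge.)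
[cite: LangeBirkenhake1992, Lemma 1.1.17 and Exercise 1.1.6 (7)–(8)] [cite: MumfordAV1970, §1 (3)–(4)] -/
theorem stub_exteriorH1 :
    ∀ A : AbelianVariety ℂ,
      HasExteriorCohomologyH1 ℂ (ComplexPoints A.X) ∧ Module.finrank ℂ (complexBetti A.X 1) = 2 * A.dim := by
  intro A
  have hfin : Module.finrank ℂ (complexBetti A.X 1) = 2 * A.dim := by
    rw [← AbelianVariety.finrank_bettiCohomology_one_eq_of_natCard_torsionPoints A
      (AbelianVariety.natCard_torsionPoints_of_isAlgClosed_holds A ℂ)]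
    change Module.finrank ℂ (singularCohomology ℂ ℂ (A.Points ℂ) 1) =
      Module.finrank ℚ (singularCohomology ℚ ℚ (A.Points ℂ) 1)
    rw [finrank_singularCohomology_eq_bettiNumber_of_field, finrank_singularCohomology_eq_bettiNumber_of_field,
      bettiNumber_eq_of_algebra ℚ ℂ]
  letI := (AbelianVariety.isSmoothProjective_holds (A := A)).chartedSpace
  exact ⟨hasExteriorCohomologyH1_of_group ℂ (G := A.Points ℂ) (n := 2 * A.dim) hfin.ge, hfin⟩

/-- **REACH with a GLOBAL Weil class, from the PEL reach and the three base-side facts** (the line's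
`stub_reach`, v4).  For a hyperbolic `(A, φ, e, a)` and a non-zero rational `(4,4)` Weil class `c`: an
embedded smooth projective family `f : 𝒳 ⟶ S` of relative dimension `8` over a smooth irreducible
quasi-projective base, `e₁ : A.X ≅ 𝒳_{s₁}`, a GLOBAL class `W ∈ H⁸(𝒳(ℂ); ℂ)` with `e₁^*(W|_{s₁}) = c`,
rational of type `(4,4)` on every fibre and lying fibrewise in typed `√-7`-Weil planes, and the dicyclic
anchor at `s₀`.  PROOF: `hPel` gives the family and the continuous section `σ` through `c`; the W-engine
`stub_globalClassOfSection` (partie fixe `hD` + Hironaka `hHir`: compactify `𝒳 ↪ 𝒳̄`, Deligne at one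
point, identity principle for continuous sections over the connected `S(ℂ)`) gives `W` with
`σ = globalSection W`; rationality along `σ` is `stub_rationalAlongSection` (flat transport of a rational
class is rational); the Hodge type along `σ` is `hCS` (Charles–Schnell 11.3.5 (1)) from the type `(4,4)` of
`c` at `s₁`; the Weil-plane and anchor clauses are read off `σ = globalSection W`.
[cite: DeligneHodgeII1971, Théorème 4.1.1] [cite: CharlesSchnell2014Notes, Theorem 11.3.4 and Proposition 11.3.5 (1)]
[cite: Hironaka1964, Main Theorem I] -/
theorem stub_reach_of_pelReach
    (hPel :
      ∀ (A : AbelianVariety ℂ) (φ : A ⟶ A), A.dim = 8 → φ ≫ φ = -((7 : ℤ) • 𝟙 A) →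
      ∀ (e : ProjectiveEmbedding A.X) (a : complexBetti (projectiveSpace e.n ℂ) 2),
        IsRationalClass a → a ≠ 0 →
        IsHyperbolicWeilType A φ 4
          ((7 : ℂ) • complexBetti.map e.ι 2 a + complexBetti.map φ.hom.hom.hom 2 (complexBetti.map e.ι 2 a)) →
      ∀ c : complexBetti A.X 8, c ≠ 0 → IsRationalClass c → IsOfHodgeType 8 A.X 8 4 4 c →
        c ∈ Module.End.eigenspace (complexBetti.map (𝟙 A + φ).hom.hom.hom 8).hom
              ((1 + Complex.I * (Real.sqrt (7 : ℝ) : ℂ)) ^ 8) ⊔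
            Module.End.eigenspace (complexBetti.map (𝟙 A + φ).hom.hom.hom 8).hom
              ((1 - Complex.I * (Real.sqrt (7 : ℝ) : ℂ)) ^ 8) →
      ∃ (𝒳 S : SchemeOver ℂ) (f : 𝒳 ⟶ S) (s₁ s₀ : ComplexPoints S) (e₁ : A.X ≅ fiberOver f s₁)
        (σ : ComplexPoints S → FiberClass f 8),
        IsSmoothProjectiveFamily f 8 ∧
        (∃ (N : ℕ) (ι : 𝒳 ⟶ projectiveSpace N ℂ ⊗ S),
            AlgebraicGeometry.IsClosedImmersion ι.left ∧
              ι ≫ CartesianMonoidalCategory.snd (projectiveSpace N ℂ) S = f) ∧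
        IrreducibleSpace S.left ∧ AlgebraicGeometry.Smooth S.hom ∧ IsQuasiProjectiveOver S ∧
        Continuous σ ∧ (∀ s, (σ s).pt = s) ∧
        σ s₁ = ⟨s₁, complexBetti.map e₁.inv 8 c⟩ ∧
        (∀ s : ComplexPoints S, ∃ (x : complexBetti (fiberOver f s) 8) (Ys : AbelianVariety ℂ)
            (ψs : Ys ⟶ Ys) (es : Ys.X ≅ fiberOver f s),
          σ s = ⟨s, x⟩ ∧ Ys.dim = 8 ∧ ψs ≫ ψs = -((7 : ℤ) • 𝟙 Ys) ∧
          complexBetti.map es.hom 8 x ∈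
            Module.End.eigenspace (complexBetti.map (𝟙 Ys + ψs).hom.hom.hom 8).hom
                ((1 + Complex.I * (Real.sqrt (7 : ℝ) : ℂ)) ^ 8) ⊔
              Module.End.eigenspace (complexBetti.map (𝟙 Ys + ψs).hom.hom.hom 8).hom
                ((1 - Complex.I * (Real.sqrt (7 : ℝ) : ℂ)) ^ 8)) ∧
        ∃ (Y : AbelianVariety ℂ) (φY ψY : Y ⟶ Y) (m : ℕ) (t : ℤ) (e₀ : Y.X ≅ fiberOver f s₀)
          (x₀ : complexBetti (fiberOver f s₀) 8),
          Y.dim = 8 ∧ 0 < m ∧ φY ≫ φY = -((7 : ℤ) • 𝟙 Y) ∧ ψY ≫ ψY = -((3 * (m : ℤ) ^ 2) • 𝟙 Y) ∧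
          φY ≫ ψY + ψY ≫ φY = t • 𝟙 Y ∧ t ^ 2 < 84 * (m : ℤ) ^ 2 ∧
          σ s₀ = ⟨s₀, x₀⟩ ∧
          complexBetti.map e₀.hom 8 x₀ ∈
            Module.End.eigenspace (complexBetti.map (𝟙 Y + φY).hom.hom.hom 8).hom
                ((1 + Complex.I * (Real.sqrt (7 : ℝ) : ℂ)) ^ 8) ⊔
              Module.End.eigenspace (complexBetti.map (𝟙 Y + φY).hom.hom.hom 8).hom
                ((1 - Complex.I * (Real.sqrt (7 : ℝ) : ℂ)) ^ 8) ∧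
          ∃ (C : SchemeOver ℂ) (𝒥 : Jacobian C) (α ξ : C ⟶ C) (s x : 𝒥.J ⟶ 𝒥.J)
            (sB xB ψ₀ : AbelianVariety.kerComponent (𝟙 𝒥.J - s + s ≫ s) ⟶
              AbelianVariety.kerComponent (𝟙 𝒥.J - s + s ≫ s))
            (fY : Y ⟶ AbelianVariety.kerComponent (𝟙 𝒥.J - s + s ≫ s))
            (gY : AbelianVariety.kerComponent (𝟙 𝒥.J - s + s ≫ s) ⟶ Y) (k : ℕ),
            IsSmoothProjective 1 C ∧ 𝒥.J.dim = 25 ∧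
            α ≫ α ≫ α ≫ α ≫ α ≫ α = 𝟙 C ∧ ξ ≫ ξ = α ≫ α ≫ α ∧ α ≫ ξ ≫ α = ξ ∧
            (∀ P : ComplexPoints C, P ≫ (α ≫ α) ≠ P ∧ P ≫ (α ≫ α ≫ α) ≠ P) ∧
            s = 𝒥.pushforward 𝒥 α ∧ x = 𝒥.pushforward 𝒥 ξ ∧
            sB ≫ AbelianVariety.kerComponentι (𝟙 𝒥.J - s + s ≫ s) =
              AbelianVariety.kerComponentι (𝟙 𝒥.J - s + s ≫ s) ≫ s ∧
            xB ≫ AbelianVariety.kerComponentι (𝟙 𝒥.J - s + s ≫ s) =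
              AbelianVariety.kerComponentι (𝟙 𝒥.J - s + s ≫ s) ≫ x ∧
            ψ₀ = 𝟙 _ + 2 • (sB ≫ sB) ∧
            0 < k ∧ AlgebraicGeometry.Flat fY.hom.hom.hom.left ∧ fY ≫ gY = (k : ℤ) • 𝟙 Y ∧
            gY ≫ ψY = ((m : ℤ) • ψ₀) ≫ gY ∧ fY ≫ ((m : ℤ) • ψ₀) = ψY ≫ fY)
    (hD : deligne_globalInvariantCycles)
    (hHir :
      ∀ (m : ℕ) (X : SchemeOver ℂ), AlgebraicGeometry.SmoothOfRelativeDimension m X.hom →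
        IsQuasiProjectiveOver X → IrreducibleSpace X.left →
        ∃ (Xbar : SchemeOver ℂ) (i : X ⟶ Xbar), IsSmoothProjective m Xbar ∧
          AlgebraicGeometry.IsOpenImmersion i.left)
    (hCS : charlesSchnell_hodgeClass_of_flat) :
    ∀ (A : AbelianVariety ℂ) (φ : A ⟶ A), A.dim = 8 → φ ≫ φ = -((7 : ℤ) • 𝟙 A) →
    ∀ (e : ProjectiveEmbedding A.X) (a : complexBetti (projectiveSpace e.n ℂ) 2),
      IsRationalClass a → a ≠ 0 →
      IsHyperbolicWeilType A φ 4
        ((7 : ℂ) • complexBetti.map e.ι 2 a + complexBetti.map φ.hom.hom.hom 2 (complexBetti.map e.ι 2 a)) →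
    ∀ c : complexBetti A.X 8, c ≠ 0 → IsRationalClass c → IsOfHodgeType 8 A.X 8 4 4 c →
      c ∈ Module.End.eigenspace (complexBetti.map (𝟙 A + φ).hom.hom.hom 8).hom
            ((1 + Complex.I * (Real.sqrt (7 : ℝ) : ℂ)) ^ 8) ⊔
          Module.End.eigenspace (complexBetti.map (𝟙 A + φ).hom.hom.hom 8).hom
            ((1 - Complex.I * (Real.sqrt (7 : ℝ) : ℂ)) ^ 8) →
    ∃ (𝒳 S : SchemeOver ℂ) (f : 𝒳 ⟶ S) (s₁ s₀ : ComplexPoints S) (e₁ : A.X ≅ fiberOver f s₁)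
      (W : complexBetti 𝒳 8),
      IsSmoothProjectiveFamily f 8 ∧
      (∃ (N : ℕ) (ι : 𝒳 ⟶ projectiveSpace N ℂ ⊗ S),
          AlgebraicGeometry.IsClosedImmersion ι.left ∧
            ι ≫ CartesianMonoidalCategory.snd (projectiveSpace N ℂ) S = f) ∧
      IrreducibleSpace S.left ∧ AlgebraicGeometry.Smooth S.hom ∧ IsQuasiProjectiveOver S ∧
      complexBetti.map e₁.hom 8 (complexBetti.map (fiberι f s₁) 8 W) = c ∧
      (∀ s : ComplexPoints S,
        IsRationalClass (complexBetti.map (fiberι f s) 8 W) ∧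
        IsOfHodgeType 8 (fiberOver f s) 8 4 4 (complexBetti.map (fiberι f s) 8 W)) ∧
      (∀ s : ComplexPoints S, ∃ (Ys : AbelianVariety ℂ) (ψs : Ys ⟶ Ys) (es : Ys.X ≅ fiberOver f s),
        Ys.dim = 8 ∧ ψs ≫ ψs = -((7 : ℤ) • 𝟙 Ys) ∧
        complexBetti.map es.hom 8 (complexBetti.map (fiberι f s) 8 W) ∈
          Module.End.eigenspace (complexBetti.map (𝟙 Ys + ψs).hom.hom.hom 8).hom
              ((1 + Complex.I * (Real.sqrt (7 : ℝ) : ℂ)) ^ 8) ⊔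
            Module.End.eigenspace (complexBetti.map (𝟙 Ys + ψs).hom.hom.hom 8).hom
              ((1 - Complex.I * (Real.sqrt (7 : ℝ) : ℂ)) ^ 8)) ∧
      ∃ (Y : AbelianVariety ℂ) (φY ψY : Y ⟶ Y) (m : ℕ) (t : ℤ) (e₀ : Y.X ≅ fiberOver f s₀),
        Y.dim = 8 ∧ 0 < m ∧ φY ≫ φY = -((7 : ℤ) • 𝟙 Y) ∧ ψY ≫ ψY = -((3 * (m : ℤ) ^ 2) • 𝟙 Y) ∧
        φY ≫ ψY + ψY ≫ φY = t • 𝟙 Y ∧ t ^ 2 < 84 * (m : ℤ) ^ 2 ∧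
        complexBetti.map e₀.hom 8 (complexBetti.map (fiberι f s₀) 8 W) ∈
          Module.End.eigenspace (complexBetti.map (𝟙 Y + φY).hom.hom.hom 8).hom
              ((1 + Complex.I * (Real.sqrt (7 : ℝ) : ℂ)) ^ 8) ⊔
            Module.End.eigenspace (complexBetti.map (𝟙 Y + φY).hom.hom.hom 8).hom
              ((1 - Complex.I * (Real.sqrt (7 : ℝ) : ℂ)) ^ 8) ∧
        ∃ (C : SchemeOver ℂ) (𝒥 : Jacobian C) (α ξ : C ⟶ C) (s x : 𝒥.J ⟶ 𝒥.J)
          (sB xB ψ₀ : AbelianVariety.kerComponent (𝟙 𝒥.J - s + s ≫ s) ⟶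
            AbelianVariety.kerComponent (𝟙 𝒥.J - s + s ≫ s))
          (fY : Y ⟶ AbelianVariety.kerComponent (𝟙 𝒥.J - s + s ≫ s))
          (gY : AbelianVariety.kerComponent (𝟙 𝒥.J - s + s ≫ s) ⟶ Y) (k : ℕ),
          IsSmoothProjective 1 C ∧ 𝒥.J.dim = 25 ∧
          α ≫ α ≫ α ≫ α ≫ α ≫ α = 𝟙 C ∧ ξ ≫ ξ = α ≫ α ≫ α ∧ α ≫ ξ ≫ α = ξ ∧
          (∀ P : ComplexPoints C, P ≫ (α ≫ α) ≠ P ∧ P ≫ (α ≫ α ≫ α) ≠ P) ∧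
          s = 𝒥.pushforward 𝒥 α ∧ x = 𝒥.pushforward 𝒥 ξ ∧
          sB ≫ AbelianVariety.kerComponentι (𝟙 𝒥.J - s + s ≫ s) =
            AbelianVariety.kerComponentι (𝟙 𝒥.J - s + s ≫ s) ≫ s ∧
          xB ≫ AbelianVariety.kerComponentι (𝟙 𝒥.J - s + s ≫ s) =
            AbelianVariety.kerComponentι (𝟙 𝒥.J - s + s ≫ s) ≫ x ∧
          ψ₀ = 𝟙 _ + 2 • (sB ≫ sB) ∧
          0 < k ∧ AlgebraicGeometry.Flat fY.hom.hom.hom.left ∧ fY ≫ gY = (k : ℤ) • 𝟙 Y ∧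
          gY ≫ ψY = ((m : ℤ) • ψ₀) ≫ gY ∧ fY ≫ ((m : ℤ) • ψ₀) = ψY ≫ fY := by
  intro A φ hA hφ e a ha ha0 hyp c hc hr hH hW
  obtain ⟨𝒳, S, f, s₁, s₀, e₁, σ, hfam, hι, hirr, hsm, hSqp, hσ, hpt, hs₁, hweil, Y, φY, ψY, m, t, e₀,
    x₀, hY, hm, hφY, hψY, hanti, ht, hx₀, hplane, hdic⟩ :=
    hPel A φ hA hφ e a ha ha0 hyp c hc hr hH hW
  -- the global class of the flat section (partie fixe F1 + Hironaka F2; W-engine PROVED in the tree)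
  obtain ⟨W, hWσ⟩ := stub_globalClassOfSection hD hHir f 8 8 hfam hι hsm
    hSqp hirr σ hσ hpt
  have hcls : ∀ (s : ComplexPoints S) (y : complexBetti (fiberOver f s) 8),
      σ s = ⟨s, y⟩ → complexBetti.map (fiberι f s) 8 W = y := fun s y hy =>
    (FiberClass.mk_eq_mk_iff _ _).1 ((hWσ s).symm.trans hy)
  -- rationality along the section (PROVED in the tree), Hodge type along the section (F3)
  have hrat₁ : IsRationalClass (σ s₁).cls := by
    rw [hs₁]
    exact hr.pullback _
  have hratσ : ∀ s, IsRationalClass (σ s).cls :=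
    stub_rationalAlongSection f 8 8 hfam hsm hSqp hirr σ hσ hpt s₁ hrat₁
  have hconn : ConnectedSpace (ComplexPoints S) := by
    haveI := hirr
    haveI : AlgebraicGeometry.LocallyOfFiniteType S.hom := hSqp.locallyOfFiniteType
    exact (ComplexPoints.connectedSpace_iff_holds S).2 inferInstance
  have hloc₁ : σ s₁ ∈ locusOfHodgeClasses f 8 4 := by
    rw [hs₁]
    exact ⟨hr.pullback _, hH.map_of_iso e₁.symm⟩
  have hlocσ : ∀ s, σ s ∈ locusOfHodgeClasses f 8 4 :=
    hCS 𝒳 S f 8 4 hfam hSqp hsm hconn σ hσ hpt hratσ s₁ hloc₁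
  refine ⟨𝒳, S, f, s₁, s₀, e₁, W, hfam, hι, hirr, hsm, hSqp, ?_, ?_, ?_, Y, φY, ψY, m, t, e₀, hY, hm,
    hφY, hψY, hanti, ht, ?_, hdic⟩
  · rw [hcls s₁ _ hs₁]
    exact map_hom_map_inv_apply e₁ 8 c
  · intro s
    have h := (mem_locusOfHodgeClasses_iff _).1 (hlocσ s)
    rw [hWσ s] at h
    exact h
  · intro s
    obtain ⟨x, Ys, ψs, es, hx, hYs, hψs, hmem⟩ := hweil s
    refine ⟨Ys, ψs, es, hYs, hψs, ?_⟩
    rw [hcls s x hx]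
    exact hmem
  · rw [hcls s₀ x₀ hx₀]
    exact hplane

/-- **`HyperbolicEightfoldsSqrtMinus7` from the line's six open statements, all as hypotheses** (the
skeleton's `HyperbolicEightfoldsSqrtMinus7_of` with its `sorry`-stubs abstracted): `hSch` = Schoen 1988 at
degree 6 (named fact), `hPel` = the PEL reach (moduli construction absent from the tree), `hD` = the partie
fixe (named fact), `hHir` = Hironaka's compactification (body of the named fact), `hCS` = Charles–Schnell
11.3.5 (1) (named fact), `hT` = the transport C⁺ (OPEN; an instance of `WeilVariationalHodge (7,4)`,
stmt-HodgeConjecture-14497).  Proof: for a rational `(4,4)` Weil class `c ≠ 0` of a hyperbolic `(A, φ)`,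
`stub_reach_of_pelReach` yields the family, the global class `W` and the dicyclic anchor fibre
`𝒳_{s₀} ≅ Y`; Schoen on the dicyclic datum (`stub_schoenDicyclic_of_schoen hSch`, fed with
`stub_exteriorH1`, `stub_endAdditiveH1`) makes the typed `ψ_Y`-plane algebraic; the quaternion field switch
(`stub_switchTransfer stub_abstractSwitch …`) gives the typed `φ_Y`-plane, which contains `e₀^*(W|_{s₀})`;
`hT` transports to `s₁`; iso-invariance (`owf_isoTransport`, `mem_algebraicClasses_map_of_iso`) along `e₀`, `e₁` moves classes between fibres and their presentations. CONDITIONAL on the six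
hypotheses; introduces nothing. [cite: Schoen1988HodgeWeil, Corollary 3.1] [cite: vanGeemen1994HodgeAV, 3.6–3.7 and 5.2–5.4]
[cite: DeligneHodgeII1971, Théorème 4.1.1] -/
theorem hyperbolicEightfoldsSqrtMinus7_of_stubs
    (hSch : Schoen1988_cyclicPrym_weilClasses_algebraic_degreeSix)
    (hPel :
      ∀ (A : AbelianVariety ℂ) (φ : A ⟶ A), A.dim = 8 → φ ≫ φ = -((7 : ℤ) • 𝟙 A) →
      ∀ (e : ProjectiveEmbedding A.X) (a : complexBetti (projectiveSpace e.n ℂ) 2),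
        IsRationalClass a → a ≠ 0 →
        IsHyperbolicWeilType A φ 4
          ((7 : ℂ) • complexBetti.map e.ι 2 a + complexBetti.map φ.hom.hom.hom 2 (complexBetti.map e.ι 2 a)) →
      ∀ c : complexBetti A.X 8, c ≠ 0 → IsRationalClass c → IsOfHodgeType 8 A.X 8 4 4 c →
        c ∈ Module.End.eigenspace (complexBetti.map (𝟙 A + φ).hom.hom.hom 8).hom
              ((1 + Complex.I * (Real.sqrt (7 : ℝ) : ℂ)) ^ 8) ⊔
            Module.End.eigenspace (complexBetti.map (𝟙 A + φ).hom.hom.hom 8).hom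
              ((1 - Complex.I * (Real.sqrt (7 : ℝ) : ℂ)) ^ 8) →
      ∃ (𝒳 S : SchemeOver ℂ) (f : 𝒳 ⟶ S) (s₁ s₀ : ComplexPoints S) (e₁ : A.X ≅ fiberOver f s₁)
        (σ : ComplexPoints S → FiberClass f 8),
        IsSmoothProjectiveFamily f 8 ∧
        (∃ (N : ℕ) (ι : 𝒳 ⟶ projectiveSpace N ℂ ⊗ S),
            AlgebraicGeometry.IsClosedImmersion ι.left ∧
              ι ≫ CartesianMonoidalCategory.snd (projectiveSpace N ℂ) S = f) ∧
        IrreducibleSpace S.left ∧ AlgebraicGeometry.Smooth S.hom ∧ IsQuasiProjectiveOver S ∧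
        Continuous σ ∧ (∀ s, (σ s).pt = s) ∧
        σ s₁ = ⟨s₁, complexBetti.map e₁.inv 8 c⟩ ∧
        (∀ s : ComplexPoints S, ∃ (x : complexBetti (fiberOver f s) 8) (Ys : AbelianVariety ℂ)
            (ψs : Ys ⟶ Ys) (es : Ys.X ≅ fiberOver f s),
          σ s = ⟨s, x⟩ ∧ Ys.dim = 8 ∧ ψs ≫ ψs = -((7 : ℤ) • 𝟙 Ys) ∧
          complexBetti.map es.hom 8 x ∈
            Module.End.eigenspace (complexBetti.map (𝟙 Ys + ψs).hom.hom.hom 8).hom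
                ((1 + Complex.I * (Real.sqrt (7 : ℝ) : ℂ)) ^ 8) ⊔
              Module.End.eigenspace (complexBetti.map (𝟙 Ys + ψs).hom.hom.hom 8).hom
                ((1 - Complex.I * (Real.sqrt (7 : ℝ) : ℂ)) ^ 8)) ∧
        ∃ (Y : AbelianVariety ℂ) (φY ψY : Y ⟶ Y) (m : ℕ) (t : ℤ) (e₀ : Y.X ≅ fiberOver f s₀)
          (x₀ : complexBetti (fiberOver f s₀) 8),
          Y.dim = 8 ∧ 0 < m ∧ φY ≫ φY = -((7 : ℤ) • 𝟙 Y) ∧ ψY ≫ ψY = -((3 * (m : ℤ) ^ 2) • 𝟙 Y) ∧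
          φY ≫ ψY + ψY ≫ φY = t • 𝟙 Y ∧ t ^ 2 < 84 * (m : ℤ) ^ 2 ∧
          σ s₀ = ⟨s₀, x₀⟩ ∧
          complexBetti.map e₀.hom 8 x₀ ∈
            Module.End.eigenspace (complexBetti.map (𝟙 Y + φY).hom.hom.hom 8).hom
                ((1 + Complex.I * (Real.sqrt (7 : ℝ) : ℂ)) ^ 8) ⊔
              Module.End.eigenspace (complexBetti.map (𝟙 Y + φY).hom.hom.hom 8).hom
                ((1 - Complex.I * (Real.sqrt (7 : ℝ) : ℂ)) ^ 8) ∧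
          ∃ (C : SchemeOver ℂ) (𝒥 : Jacobian C) (α ξ : C ⟶ C) (s x : 𝒥.J ⟶ 𝒥.J)
            (sB xB ψ₀ : AbelianVariety.kerComponent (𝟙 𝒥.J - s + s ≫ s) ⟶
              AbelianVariety.kerComponent (𝟙 𝒥.J - s + s ≫ s))
            (fY : Y ⟶ AbelianVariety.kerComponent (𝟙 𝒥.J - s + s ≫ s))
            (gY : AbelianVariety.kerComponent (𝟙 𝒥.J - s + s ≫ s) ⟶ Y) (k : ℕ),
            IsSmoothProjective 1 C ∧ 𝒥.J.dim = 25 ∧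
            α ≫ α ≫ α ≫ α ≫ α ≫ α = 𝟙 C ∧ ξ ≫ ξ = α ≫ α ≫ α ∧ α ≫ ξ ≫ α = ξ ∧
            (∀ P : ComplexPoints C, P ≫ (α ≫ α) ≠ P ∧ P ≫ (α ≫ α ≫ α) ≠ P) ∧
            s = 𝒥.pushforward 𝒥 α ∧ x = 𝒥.pushforward 𝒥 ξ ∧
            sB ≫ AbelianVariety.kerComponentι (𝟙 𝒥.J - s + s ≫ s) =
              AbelianVariety.kerComponentι (𝟙 𝒥.J - s + s ≫ s) ≫ s ∧
            xB ≫ AbelianVariety.kerComponentι (𝟙 𝒥.J - s + s ≫ s) =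
              AbelianVariety.kerComponentι (𝟙 𝒥.J - s + s ≫ s) ≫ x ∧
            ψ₀ = 𝟙 _ + 2 • (sB ≫ sB) ∧
            0 < k ∧ AlgebraicGeometry.Flat fY.hom.hom.hom.left ∧ fY ≫ gY = (k : ℤ) • 𝟙 Y ∧
            gY ≫ ψY = ((m : ℤ) • ψ₀) ≫ gY ∧ fY ≫ ((m : ℤ) • ψ₀) = ψY ≫ fY)
    (hD : deligne_globalInvariantCycles)
    (hHir :
      ∀ (m : ℕ) (X : SchemeOver ℂ), AlgebraicGeometry.SmoothOfRelativeDimension m X.hom →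
        IsQuasiProjectiveOver X → IrreducibleSpace X.left →
        ∃ (Xbar : SchemeOver ℂ) (i : X ⟶ Xbar), IsSmoothProjective m Xbar ∧
          AlgebraicGeometry.IsOpenImmersion i.left)
    (hCS : charlesSchnell_hodgeClass_of_flat)
    (hT :
      ∀ ⦃𝒳 S : SchemeOver ℂ⦄ (f : 𝒳 ⟶ S), IsSmoothProjectiveFamily f 8 →
        (∃ (N : ℕ) (ι : 𝒳 ⟶ projectiveSpace N ℂ ⊗ S),
            AlgebraicGeometry.IsClosedImmersion ι.left ∧
              ι ≫ CartesianMonoidalCategory.snd (projectiveSpace N ℂ) S = f) →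
        IrreducibleSpace S.left → AlgebraicGeometry.Smooth S.hom → IsQuasiProjectiveOver S →
      ∀ (W : complexBetti 𝒳 8),
        (∀ s : ComplexPoints S,
          IsRationalClass (complexBetti.map (fiberι f s) 8 W) ∧
          IsOfHodgeType 8 (fiberOver f s) 8 4 4 (complexBetti.map (fiberι f s) 8 W)) →
        (∀ s : ComplexPoints S, ∃ (Ys : AbelianVariety ℂ) (ψs : Ys ⟶ Ys) (es : Ys.X ≅ fiberOver f s),
          Ys.dim = 8 ∧ ψs ≫ ψs = -((7 : ℤ) • 𝟙 Ys) ∧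
          complexBetti.map es.hom 8 (complexBetti.map (fiberι f s) 8 W) ∈
            Module.End.eigenspace (complexBetti.map (𝟙 Ys + ψs).hom.hom.hom 8).hom
                ((1 + Complex.I * (Real.sqrt (7 : ℝ) : ℂ)) ^ 8) ⊔
              Module.End.eigenspace (complexBetti.map (𝟙 Ys + ψs).hom.hom.hom 8).hom
                ((1 - Complex.I * (Real.sqrt (7 : ℝ) : ℂ)) ^ 8)) →
      ∀ s₀ : ComplexPoints S,
        (∃ (Y : AbelianVariety ℂ) (φY ψY : Y ⟶ Y) (m : ℕ) (t : ℤ) (e₀ : Y.X ≅ fiberOver f s₀),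
          Y.dim = 8 ∧ 0 < m ∧ φY ≫ φY = -((7 : ℤ) • 𝟙 Y) ∧ ψY ≫ ψY = -((3 * (m : ℤ) ^ 2) • 𝟙 Y) ∧
          φY ≫ ψY + ψY ≫ φY = t • 𝟙 Y ∧ t ^ 2 < 84 * (m : ℤ) ^ 2 ∧
          complexBetti.map e₀.hom 8 (complexBetti.map (fiberι f s₀) 8 W) ∈
            Module.End.eigenspace (complexBetti.map (𝟙 Y + φY).hom.hom.hom 8).hom
                ((1 + Complex.I * (Real.sqrt (7 : ℝ) : ℂ)) ^ 8) ⊔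
              Module.End.eigenspace (complexBetti.map (𝟙 Y + φY).hom.hom.hom 8).hom
                ((1 - Complex.I * (Real.sqrt (7 : ℝ) : ℂ)) ^ 8)) →
        complexBetti.map (fiberι f s₀) 8 W ∈ algebraicClasses (fiberOver f s₀) 4 →
      ∀ s : ComplexPoints S, complexBetti.map (fiberι f s) 8 W ∈ algebraicClasses (fiberOver f s) 4) :
    Summit.HodgeConjecture.HodgeConjecture.Theses.HeckePrymWeil.HyperbolicEightfoldsSqrtMinus7 := by
  intro A φ hA hφ e a ha ha0 hyp c hr hH hW
  by_cases hc : c = 0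
  · rw [hc]
    exact Submodule.zero_mem _
  obtain ⟨𝒳, S, f, s₁, s₀, e₁, W, hf, hι, hirr, hsm, hSqp, hWc, hall, hweil, Y, φY, ψY, m, t, e₀, hY,
    hm, hφY, hψY, hanti, ht, hplane, C, 𝒥, α, ξ, s, x, sB, xB, ψ₀, fY, gY, k, hC, hg25, hα6, hξ2, hrel,
    hfree, hs, hx, hsB, hxB, hψ₀, hk, hflat, hfg, hgψ, hfψ⟩ :=
    stub_reach_of_pelReach hPel hD hHir hCS A φ hA hφ e a ha ha0 hyp c hc hr hH hW
  -- Schoen on the dicyclic datum + isogeny invariance: the typed `ψ_Y`-plane of `Y` is algebraic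
  have hψalg := stub_schoenDicyclic_of_schoen hSch stub_exteriorH1 stub_endAdditiveH1 C 𝒥 α ξ hC hg25 hα6 hξ2 hrel
    hfree s x hs hx sB xB ψ₀ hsB hxB hψ₀ Y ψY m k fY gY hm hk hflat hfg hgψ hfψ
  -- the switch: the typed `φ_Y`-plane of `Y` is algebraic
  have hφalg := stub_switchTransfer stub_abstractSwitch stub_exteriorH1 stub_endAdditiveH1 Y φY ψY m t
    hY hm hφY hψY hanti ht hψalg
  -- at the anchor fibre
  have h0 : complexBetti.map (fiberι f s₀) 8 W ∈ algebraicClasses (fiberOver f s₀) 4 :=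
    owf_isoTransport _ Y e₀ 4 _ (hφalg _ hplane)
  -- transport to `s₁` (the anchor hypothesis of `hT` is the quaternionic datum of `Y`)
  have h1 : complexBetti.map (fiberι f s₁) 8 W ∈ algebraicClasses (fiberOver f s₁) 4 :=
    hT f hf hι hirr hsm hSqp W hall hweil s₀
      ⟨Y, φY, ψY, m, t, e₀, hY, hm, hφY, hψY, hanti, ht, hplane⟩ h0 s₁
  -- along `e₁ : A ≅ 𝒳_{s₁}`
  have key := mem_algebraicClasses_map_of_iso (p := 4) (hf.isSmoothProjective s₁)
    (AbelianVariety.isSmoothProjective_holds (A := A)) e₁ h1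
  rw [hWc] at key
  exact key

end Summit.HodgeConjecture.HodgeConjecture.Theorems.HyperbolicEightfoldsSqrtMinus7.DicyclicQuaternionSwitch

end
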